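import Literature.AlgebraicGeometry.Morphisms.SectionsFpqcDescentChart
import Literature.AlgebraicGeometry.Modules.AffineVectorBundleSections
import Literature.AlgebraicGeometry.Modules.DetClassOfIso
import Literature.RingTheory.Flat.FiniteProjectiveDescent
import HarnessLib

/-!
# Finite projectivity descends along a faithfully flat affine chart: the `hproj` token of module descent along a torsor quotient

Layer `Literature/AlgebraicGeometry/RelativeSpec`, namespace `Literature.AlgebraicGeometry.RelativeSpec.TorsorQuotient`.  THEOREMS ONLY (no definition, no
named fact, no instance, no notation, no `sorry`).

THE PRINT.  [MumfordAV1970] §12 Thm. 1 (B) (p. 112) and [SGA1] Exp. VIII Prop. 1.10: along a faithfully flat quasi-compact `q : X → Y` a quasi-coherent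
`𝒪_Y`-module `P` is locally free of finite rank as soon as `q^*P` is; affine-locally ([StacksProject, Tag 058S], descent of finite projectivity,
and Tag 03C4, descent of finite presentation): for `R → S` faithfully flat and an `R`-module `N` with `S ⊗_R N` finite projective over `S`, `N` is finite
projective over `R`.  THIS FILE is the CHART STEP of that statement in the currency of ★ `Morphisms/SectionsFpqcDescentChart`: `q : X ⟶ Y` flat and
surjective, `V ⊆ Y` an affine open with `U := q⁻¹V` affine (so `R := Γ(Y, V) → S := Γ(X, U)` is faithfully flat, ★ `Morphisms.faithfullyFlat_appLE`), `E` a finite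
locally free `𝒪_X`-module (so `Γ(E, U)` is a finite projective `S`-module, ★ `Modules.finite_projective_sections_of_isFiniteLocallyFree`), and an `R`-module `N`
with an `R`-linear `j : N → Γ(E, U)` exhibiting `Γ(E, U)` as the base change `S ⊗_R N` (`IsBaseChange S j` — the conclusion dress of the chart organ (ii) of the
P6b wave-C §D line, `RelativeSpec/TorsorQuotientModuleChart.isBaseChange_of_range_eq_equaliser`) ⟹ **`N` is finite projective over `R`**, by ONE call of ★
`RingTheory/Flat/FiniteProjectiveDescent` (`FaithfullyFlatDescent.finite_projective_of_isBaseChange`, the module form of Tags 058S ∕ 03C4).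

* `finite_projective_of_isBaseChange_chart` — the statement above (HEAD);
* `finite_projective_of_isBaseChange_chart_of_hasRank` — with `HasRank E r` in place of `IsFiniteLocallyFree E` (★ `HasRank.isFiniteLocallyFree'`);
* `finite_projective_of_isBaseChange_chart_of_isAffineHom` — with `[IsAffineHom q]` supplying `U = q⁻¹V` affine (Mathlib `IsAffineOpen.preimage`).

CONSUMER (cell `pub/hodgecm-mathlib`, P6b wave C of §D `stub_L4B1uD_mumfordLambdaDescent`, dealt by desk F0P6b-plan (g14) 10:08:24Z as «`hproj` PRODUCER ON THE
CHART»): the binder `hproj : ∀ V : Q.left.Opens, IsAffineOpen V → Module.Finite Γ(Q.left, V) Γ((π_*E)^G, V) ∧ Module.Projective Γ(Q.left, V) Γ((π_*E)^G, V)` of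
`RelativeSpec/TorsorQuotientModuleDescent.exists_descent_of_hasRank` (organ (iii)), at `q := π.left`, `N := Γ((π_*E)^G, V)`, `j := ι.app V`, `hj :=` organ (ii)'s
chart head.  The module ∕ algebra structures in the statement are EXACTLY those of that head (`(q.appLE V (q⁻¹V) le_rfl).hom.toAlgebra`, `Module.compHom`, the
`mul_smul` scalar tower), so the junction is a plain application.  Generic, count-neutral capital on `--supports stmt-HodgeConjecture-24832`; HC_CM is proved only
modulo the printed citations until rung 0 closes; nothing here is about HC.

## References
* [MumfordAV1970] D. Mumford, *Abelian Varieties* (1970), §12 Thm. 1 (B) (p. 112).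
* [SGA1] A. Grothendieck, M. Raynaud, *SGA 1* (LNM 224), Exp. VIII Prop. 1.10.
* [StacksProject] The Stacks Project, Tag 058S, Tag 03C4, Tag 023M.
* [GortzWedhorn2020] U. Görtz, T. Wedhorn, *Algebraic Geometry I*, 2nd ed. (2020), Prop. 14.68 (faithful flatness of `Γ(V) → Γ(q⁻¹V)`), Cor. 7.42
  (sections of a locally free module over an affine scheme are finite projective).
-/

noncomputable section

-- `TopCat.Presheaf`/`Scheme.Modules` are not reducible (as in Mathlib's `AlgebraicGeometry/Modules` and ★ `SectionsFpqcDescentChart`).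
set_option backward.isDefEq.respectTransparency false

universe u v

open CategoryTheory CategoryTheory.Limits AlgebraicGeometry TopologicalSpace Opposite TensorProduct
open Literature.AlgebraicGeometry.Modules Literature.AlgebraicGeometry.Morphisms Literature.AlgebraicGeometry.Motives

namespace Literature.AlgebraicGeometry.RelativeSpec.TorsorQuotient

variable {X Y : Scheme.{u}} (q : X ⟶ Y) (E : X.Modules) {V : Y.Opens}

/-- **FINITE PROJECTIVITY DESCENDS ALONG A FAITHFULLY FLAT AFFINE CHART.**  `q : X → Y` flat and surjective, `V ⊆ Y` affine with `U = q⁻¹V` affine, `E` finite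
locally free on `X`, `N` an `R = Γ(Y, V)`-module and `j : N → Γ(E, U)` an `R`-linear map with `IsBaseChange Γ(X, U) j` (`Γ(E, U) = Γ(X, U) ⊗_R N` through `j`):
then `N` is a finite projective `R`-module — `Γ(V) → Γ(U)` is faithfully flat (★ `faithfullyFlat_appLE`), `Γ(E, U)` is finite projective over `Γ(U)` (★
`finite_projective_sections_of_isFiniteLocallyFree`), and finite projectivity descends along faithfully flat ring maps (★ `FaithfullyFlatDescent.finite_projective_of_isBaseChange`).
[cite: StacksProject, Tag 058S] [cite: SGA1, Exp. VIII Prop. 1.10] [cite: MumfordAV1970, §12 Thm. 1 (B) (p. 112)] -/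
theorem finite_projective_of_isBaseChange_chart [Flat q] [Surjective q] (hE : IsFiniteLocallyFree E)
    (hV : IsAffineOpen V) (hU : IsAffineOpen (q ⁻¹ᵁ V))
    {N : Type v} [AddCommGroup N] [Module Γ(Y, V) N]
    (j : letI : Module Γ(Y, V) Γ(E, q ⁻¹ᵁ V) := Module.compHom _ (q.appLE V (q ⁻¹ᵁ V) le_rfl).hom
      N →ₗ[Γ(Y, V)] Γ(E, q ⁻¹ᵁ V))
    (hj : letI := (q.appLE V (q ⁻¹ᵁ V) le_rfl).hom.toAlgebra
      letI : Module Γ(Y, V) Γ(E, q ⁻¹ᵁ V) := Module.compHom _ (q.appLE V (q ⁻¹ᵁ V) le_rfl).hom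
      haveI : IsScalarTower Γ(Y, V) Γ(X, q ⁻¹ᵁ V) Γ(E, q ⁻¹ᵁ V) :=
        ⟨fun a b x => mul_smul ((q.appLE V (q ⁻¹ᵁ V) le_rfl).hom a) b x⟩
      IsBaseChange Γ(X, q ⁻¹ᵁ V) j) :
    Module.Finite Γ(Y, V) N ∧ Module.Projective Γ(Y, V) N := by
  letI := (q.appLE V (q ⁻¹ᵁ V) le_rfl).hom.toAlgebra
  letI : Module Γ(Y, V) Γ(E, q ⁻¹ᵁ V) := Module.compHom _ (q.appLE V (q ⁻¹ᵁ V) le_rfl).hom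
  haveI : IsScalarTower Γ(Y, V) Γ(X, q ⁻¹ᵁ V) Γ(E, q ⁻¹ᵁ V) :=
    ⟨fun a b x => mul_smul ((q.appLE V (q ⁻¹ᵁ V) le_rfl).hom a) b x⟩
  -- `Γ(V) → Γ(U)` is faithfully flat
  haveI : Module.FaithfullyFlat Γ(Y, V) Γ(X, q ⁻¹ᵁ V) := faithfullyFlat_appLE q hV hU
  -- `Γ(E, U)` is a finite projective `Γ(U)`-module
  obtain ⟨hfin, hproj⟩ := finite_projective_sections_of_isFiniteLocallyFree hE hU
  -- finite projectivity descends along the faithfully flat `Γ(V) → Γ(U)`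
  exact Literature.RingTheory.Flat.FaithfullyFlatDescent.finite_projective_of_isBaseChange hj

/-- **The `HasRank` form** (the shape organ (iii) `TorsorQuotientModuleDescent.exists_descent_of_hasRank` carries): `E` of rank `r` is finite locally free
(★ `HasRank.isFiniteLocallyFree'`), so `finite_projective_of_isBaseChange_chart` applies. [cite: SGA1, Exp. VIII Prop. 1.10] [cite: StacksProject, Tag 058S] -/
theorem finite_projective_of_isBaseChange_chart_of_hasRank [Flat q] [Surjective q] {r : ℕ} (hE : HasRank E r)
    (hV : IsAffineOpen V) (hU : IsAffineOpen (q ⁻¹ᵁ V))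
    {N : Type v} [AddCommGroup N] [Module Γ(Y, V) N]
    (j : letI : Module Γ(Y, V) Γ(E, q ⁻¹ᵁ V) := Module.compHom _ (q.appLE V (q ⁻¹ᵁ V) le_rfl).hom
      N →ₗ[Γ(Y, V)] Γ(E, q ⁻¹ᵁ V))
    (hj : letI := (q.appLE V (q ⁻¹ᵁ V) le_rfl).hom.toAlgebra
      letI : Module Γ(Y, V) Γ(E, q ⁻¹ᵁ V) := Module.compHom _ (q.appLE V (q ⁻¹ᵁ V) le_rfl).hom
      haveI : IsScalarTower Γ(Y, V) Γ(X, q ⁻¹ᵁ V) Γ(E, q ⁻¹ᵁ V) :=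
        ⟨fun a b x => mul_smul ((q.appLE V (q ⁻¹ᵁ V) le_rfl).hom a) b x⟩
      IsBaseChange Γ(X, q ⁻¹ᵁ V) j) :
    Module.Finite Γ(Y, V) N ∧ Module.Projective Γ(Y, V) N :=
  finite_projective_of_isBaseChange_chart q E (HasRank.isFiniteLocallyFree' hE) hV hU j hj

/-- **The affine-morphism form**: for `q` affine, `U = q⁻¹V` is affine with `V` (Mathlib `IsAffineOpen.preimage`), so only `IsAffineOpen V` is a hypothesis — the
literal shape of organ (iii)'s binder `hproj : ∀ V, IsAffineOpen V → Module.Finite Γ(Q, V) N_V ∧ Module.Projective Γ(Q, V) N_V` under `[IsAffineHom π.left]`.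
[cite: SGA1, Exp. VIII Prop. 1.10] [cite: StacksProject, Tag 058S] -/
theorem finite_projective_of_isBaseChange_chart_of_isAffineHom [IsAffineHom q] [Flat q] [Surjective q] {r : ℕ} (hE : HasRank E r)
    (hV : IsAffineOpen V)
    {N : Type v} [AddCommGroup N] [Module Γ(Y, V) N]
    (j : letI : Module Γ(Y, V) Γ(E, q ⁻¹ᵁ V) := Module.compHom _ (q.appLE V (q ⁻¹ᵁ V) le_rfl).hom
      N →ₗ[Γ(Y, V)] Γ(E, q ⁻¹ᵁ V))
    (hj : letI := (q.appLE V (q ⁻¹ᵁ V) le_rfl).hom.toAlgebra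
      letI : Module Γ(Y, V) Γ(E, q ⁻¹ᵁ V) := Module.compHom _ (q.appLE V (q ⁻¹ᵁ V) le_rfl).hom
      haveI : IsScalarTower Γ(Y, V) Γ(X, q ⁻¹ᵁ V) Γ(E, q ⁻¹ᵁ V) :=
        ⟨fun a b x => mul_smul ((q.appLE V (q ⁻¹ᵁ V) le_rfl).hom a) b x⟩
      IsBaseChange Γ(X, q ⁻¹ᵁ V) j) :
    Module.Finite Γ(Y, V) N ∧ Module.Projective Γ(Y, V) N :=
  finite_projective_of_isBaseChange_chart_of_hasRank q E hE hV (hV.preimage q) j hj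

end Literature.AlgebraicGeometry.RelativeSpec.TorsorQuotient

end
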